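import Summits.ValiantsHypothesis.ValiantsHypothesis.Theorems.LacunarySymmetroidMatrixDescartesCensusDoorA34NullEndLift
import Summits.ValiantsHypothesis.ValiantsHypothesis.Theorems.LacunarySymmetroidMatrixDescartesCensusMirror

/-!
# `MatrixDescartes` census — DOOR A at `(3,4)`: the NULL-END LIFT at the TOP end (a null-top chain-eighteen lifts to a nineteen)

HONEST FRAMING.  Object-search cell `pub-symmetroid`, route `LacunarySymmetroid`; this file sits beside ONE typed statement,
the route item `Theses.LacunarySymmetroid.DoorA34` (stmt-ValiantsHypothesis-19980, `= DoorA34 = PosRootLawAt 3 4 18`), which is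
OPEN and asserted nowhere.  It transports the bottom-end lift of `…CensusDoorA34NullEndLift` (`nineteen_of_nullBottom_eighteen`)
to the TOP end by the mirror `x ↦ x⁻¹` of `…CensusMirror`, so that the statement is available on the support `d` itself (not only
on its mirror):

* `altChain_mirror` — an alternation chain of `N + 1` positive points for `det (Σ_l X^{d l} S l)` (`d l ≤ M`) is turned by
  `a ↦ a⁻¹` (order reversed) into an alternation chain of `N + 1` points for the mirrored pencil `det (Σ_l X^{M − d l} S l)`
  (`Q(x) = x^{3M} P(x⁻¹)` on `x > 0`, `Census.det_pencil_mirror_eval`).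
* `nineteen_of_nullTop_eighteen` — **NULL-END LIFT at `(3,4)`, top end**: if `d l < d 3` (`l ≠ 3`), the top letter is singular
  of adjugate rank (`det S₃ = 0`, `kᵀ adj(S₃) k ≠ 0`), and the pencil determinant carries an alternation chain of `N + 1` positive
  points, then for some real `η` the symmetric pencil with top letter `S₃ + η·kkᵀ` (same support) has at least `N + 1` distinct
  positive det-roots.  With `N = 18`: a NULL-TOP EIGHTEEN LIFTS TO A NINETEEN.  (Mirror the chain, lift at the bottom of the
  mirrored pencil `l ↦ (d 3 − d (rev l), S (rev l))`, mirror the root count back with `Census.card_posRoots_det_pencil_mirror`.)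
* `no_nullTop_eighteen_of_posRootLawOn` — contrapositive in row currency: a kernel proof of `PosRootLawOn 3 4 18 d` excludes
  null-top chain-eighteens on `d` (the census maximisers of record sit next to this stratum: top letters within `1e-9` of singular).

NOTHING here asserts that such boundary objects exist or do not exist; nothing bounds `ζ_sym(3,4)`; `DoorA34` stays OPEN; nothing
bears on `MatrixDescartes` (stmt-ValiantsHypothesis-18050) or on `VP ≠ VNP`.

[folklore] `x ↦ x⁻¹` on `(0, ∞)`; matrix determinant lemma; no citation is needed.
-/

-- `Summit.ValiantsHypothesis.ValiantsHypothesis.…` repeats a component by the D-0017 layout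
-- (single-conjunct summit), which the `dupNamespace` linter flags; the name is mandated.
set_option linter.dupNamespace false

namespace Summit.ValiantsHypothesis.ValiantsHypothesis.Theorems.LacunarySymmetroidMatrixDescartes.Census

open Polynomial Finset
open scoped BigOperators Polynomial Matrix
open Summit.ValiantsHypothesis.ValiantsHypothesis.Theorems.MatrixDescartes.Negative (PosRootLawAt)

/-- **Mirroring an alternation chain.**  If `det (Σ_l X^{d l} S l)` (`d l ≤ M`, any size `m`) carries an alternation chain of
`N + 1` positive points `a₀ < ⋯ < a_N`, then the mirrored pencil `det (Σ_l X^{M − d l} S l)` carries the alternation chain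
`a_N⁻¹ < ⋯ < a₀⁻¹`, anchored with the sign of the original determinant at `a_N`. [folklore] -/
theorem altChain_mirror {m K : ℕ} (d : Fin K → ℕ) (M : ℕ) (hd : ∀ l, d l ≤ M) (S : Fin K → Matrix (Fin m) (Fin m) ℝ)
    {N : ℕ} {s : ℝ} {a : Fin (N + 1) → ℝ}
    (h : AltChain ((∑ l, (X : ℝ[X]) ^ d l • (S l).map C).det) N s a) :
    AltChain ((∑ l, (X : ℝ[X]) ^ (M - d l) • (S l).map C).det) N
      (((∑ l, (X : ℝ[X]) ^ d l • (S l).map C).det).eval (a (Fin.last N))) (fun i => (a (Fin.rev i))⁻¹) := by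
  obtain ⟨hmono, ha0, halt, hanc⟩ := h
  set P : ℝ[X] := (∑ l, (X : ℝ[X]) ^ d l • (S l).map C).det with hP
  set Q : ℝ[X] := (∑ l, (X : ℝ[X]) ^ (M - d l) • (S l).map C).det with hQ
  have hpos : ∀ i, 0 < a i := fun i => lt_of_lt_of_le ha0 (hmono.monotone (Fin.zero_le i))
  have keyQ : ∀ i, Q.eval (a i)⁻¹ = ((a i)⁻¹ ^ M) ^ m * P.eval (a i) := by
    intro i
    rw [hQ, hP, eval_det_pencil_eq, eval_det_pencil_eq, det_pencil_mirror_eval d M hd S (a i)⁻¹ (inv_ne_zero (hpos i).ne'),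
      inv_inv]
  have hfac : ∀ i, 0 < ((a i)⁻¹ ^ M) ^ m := fun i => pow_pos (pow_pos (inv_pos.mpr (hpos i)) _) _
  -- every chain point is a non-root of `P`
  have hPnz : ∀ i, P.eval (a i) ≠ 0 := by
    intro i
    rcases Fin.eq_zero_or_eq_succ i with h0 | ⟨j, rfl⟩
    · subst h0; intro h0; rw [h0, mul_zero] at hanc; exact lt_irrefl _ hanc
    · intro h0; have := halt j; rw [h0, mul_zero] at this; exact lt_irrefl _ this
  refine ⟨?_, ?_, ?_, ?_⟩
  · -- strictly increasing: `i < j ⇒ rev j < rev i ⇒ a (rev j) < a (rev i) ⇒ inverses increase`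
    intro i j hij
    have h1 : a (Fin.rev j) < a (Fin.rev i) := hmono (Fin.rev_lt_rev.mpr hij)
    exact (inv_lt_inv₀ (hpos _) (hpos _)).mpr h1
  · exact inv_pos.mpr (hpos _)
  · intro i
    -- with `j = rev i : Fin N`: `rev (castSucc i) = succ j`, `rev (succ i) = castSucc j`
    set j : Fin N := Fin.rev i with hj
    have h1 : Fin.rev (Fin.castSucc i) = Fin.succ j := by rw [hj, Fin.rev_castSucc]
    have h2 : Fin.rev (Fin.succ i) = Fin.castSucc j := by rw [hj, Fin.rev_succ]
    show Q.eval (a (Fin.rev (Fin.castSucc i)))⁻¹ * Q.eval (a (Fin.rev (Fin.succ i)))⁻¹ < 0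
    rw [h1, h2, keyQ, keyQ]
    have hprod : P.eval (a j.succ) * P.eval (a j.castSucc) < 0 := by
      rw [mul_comm]; exact halt j
    have e : ((a j.succ)⁻¹ ^ M) ^ m * P.eval (a j.succ) * (((a j.castSucc)⁻¹ ^ M) ^ m * P.eval (a j.castSucc))
        = (((a j.succ)⁻¹ ^ M) ^ m * ((a j.castSucc)⁻¹ ^ M) ^ m) * (P.eval (a j.succ) * P.eval (a j.castSucc)) := by ring
    rw [e]
    exact mul_neg_of_pos_of_neg (mul_pos (hfac _) (hfac _)) hprod
  · -- anchor: `s' = P(a_N)` and `Q(a_N⁻¹) = (+) · P(a_N)`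
    show 0 < P.eval (a (Fin.last N)) * Q.eval (a (Fin.rev 0))⁻¹
    rw [Fin.rev_zero, keyQ]
    have e : P.eval (a (Fin.last N)) * (((a (Fin.last N))⁻¹ ^ M) ^ m * P.eval (a (Fin.last N)))
        = ((a (Fin.last N))⁻¹ ^ M) ^ m * (P.eval (a (Fin.last N)) * P.eval (a (Fin.last N))) := by ring
    rw [e]
    exact mul_pos (hfac _) (mul_self_pos.mpr (hPnz _))

/-- re-indexing the letters by `Fin.rev` does not change a pencil. [folklore] -/
theorem pencil_comp_rev (d : Fin 4 → ℕ) (S : Fin 4 → Matrix (Fin 3) (Fin 3) ℝ) :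
    (∑ l, (X : ℝ[X]) ^ d (Fin.rev l) • (S (Fin.rev l)).map C) = ∑ l, (X : ℝ[X]) ^ d l • (S l).map C :=
  pencil_comp_equiv Fin.revPerm d S

/-- **NULL-END LIFT at `(3,4)` (top end).**  Let `d l < d 3` for `l ≠ 3`, the top letter singular with `kᵀ adj(S 3) k ≠ 0`,
and let the pencil determinant carry an alternation chain of `N + 1` positive points.  Then for some real `η` the symmetric pencil
with top letter `S 3 + η·kkᵀ` (same support) has at least `N + 1` distinct positive det-roots.  With `N = 18`: a NULL-TOP
EIGHTEEN LIFTS TO A NINETEEN. [folklore] -/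
theorem nineteen_of_nullTop_eighteen (d : Fin 4 → ℕ) (h3 : ∀ l, l ≠ 3 → d l < d 3)
    (S : Fin 4 → Matrix (Fin 3) (Fin 3) ℝ) (hdet : (S 3).det = 0)
    (k : Fin 3 → ℝ) (hk : k ⬝ᵥ ((S 3).adjugate *ᵥ k) ≠ 0)
    {N : ℕ} {s : ℝ} {a : Fin (N + 1) → ℝ}
    (hchain : AltChain ((∑ l, (X : ℝ[X]) ^ d l • (S l).map C).det) N s a) :
    ∃ η : ℝ, N + 1 ≤ ((((∑ l, (X : ℝ[X]) ^ d l •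
      ((S l + if l = 3 then η • Matrix.vecMulVec k k else 0)).map C)).det).roots.toFinset.filter (fun t => 0 < t)).card := by
  classical
  have hd : ∀ l, d l ≤ d 3 := fun l => by
    by_cases hl : l = 3
    · rw [hl]
    · exact (h3 l hl).le
  -- the mirrored, re-indexed pencil
  set d' : Fin 4 → ℕ := fun l => d 3 - d (Fin.rev l) with hd'
  set S' : Fin 4 → Matrix (Fin 3) (Fin 3) ℝ := fun l => S (Fin.rev l) with hS'
  have hrev0 : Fin.rev (0 : Fin 4) = 3 := by decide
  have h0' : ∀ l, l ≠ 0 → d' 0 < d' l := by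
    intro l hl
    have hne : Fin.rev l ≠ 3 := fun h => hl (by
      have := congrArg Fin.rev h; simpa using this)
    simp only [hd', hrev0]
    have := h3 _ hne
    omega
  have hdet' : (S' 0).det = 0 := by simp only [hS', hrev0]; exact hdet
  have hk' : k ⬝ᵥ ((S' 0).adjugate *ᵥ k) ≠ 0 := by simp only [hS', hrev0]; exact hk
  -- mirrored chain, for the re-indexed mirrored pencil
  have hmir := altChain_mirror d (d 3) hd S hchain
  have hpencil : (∑ l, (X : ℝ[X]) ^ d' l • (S' l).map C) = ∑ l, (X : ℝ[X]) ^ (d 3 - d l) • (S l).map C := by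
    simp only [hd', hS']
    exact pencil_comp_equiv Fin.revPerm (fun l => d 3 - d l) S
  have hchain' : AltChain ((∑ l, (X : ℝ[X]) ^ d' l • (S' l).map C).det) N
      ((((∑ l, (X : ℝ[X]) ^ d l • (S l).map C).det).eval (a (Fin.last N)))) (fun i => (a (Fin.rev i))⁻¹) := by
    rw [hpencil]; exact hmir
  -- lift at the bottom of the mirrored pencil
  obtain ⟨η, hη⟩ := nineteen_of_nullBottom_eighteen d' h0' S' hdet' k hk' hchain'
  refine ⟨η, ?_⟩
  -- mirror the count back
  set T : Fin 4 → Matrix (Fin 3) (Fin 3) ℝ := fun l => S l + if l = 3 then η • Matrix.vecMulVec k k else 0 with hT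
  have hT' : (fun l => S' l + if l = 0 then η • Matrix.vecMulVec k k else 0) = fun l => T (Fin.rev l) := by
    funext l
    simp only [hS', hT]
    have : (l = 0) ↔ (Fin.rev l = 3) := by
      constructor
      · intro h; rw [h]; decide
      · intro h; have := congrArg Fin.rev h; simpa using this
    by_cases hl : l = 0
    · rw [if_pos hl, if_pos (this.mp hl)]
    · rw [if_neg hl, if_neg (fun h => hl (this.mpr h))]
  have hpencilT : (∑ l, (X : ℝ[X]) ^ d' l • ((fun l => S' l + if l = 0 then η • Matrix.vecMulVec k k else 0) l).map C)
      = ∑ l, (X : ℝ[X]) ^ (d 3 - d l) • (T l).map C := by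
    rw [hT']
    simp only [hd']
    exact pencil_comp_equiv Fin.revPerm (fun l => d 3 - d l) T
  rw [hpencilT, card_posRoots_det_pencil_mirror d (d 3) hd T] at hη
  exact hη

/-- the top-perturbed letters stay symmetric. [folklore] -/
theorem perturb_rankOne_top_isSymm (S : Fin 4 → Matrix (Fin 3) (Fin 3) ℝ) (hS : ∀ l, (S l).IsSymm) (k : Fin 3 → ℝ) (η : ℝ)
    (l : Fin 4) : (S l + if l = 3 then η • Matrix.vecMulVec k k else 0).IsSymm := by
  split_ifs
  · refine (hS l).add (Matrix.IsSymm.smul ?_ η)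
    unfold Matrix.IsSymm
    ext i j
    simp [Matrix.vecMulVec_apply, mul_comm]
  · rw [add_zero]; exact hS l

/-- **DOOR-A READING (null-top chain-eighteens).**  On a support `d` with `d l < d 3` (`l ≠ 3`) where the row `PosRootLawOn 3 4 18 d`
holds, NO real symmetric `(3,4)` pencil with singular top letter of adjugate rank (`det S 3 = 0`, `kᵀ adj(S 3) k ≠ 0` for some `k`)
carries an alternation chain of `19` positive points: it would lift to a nineteen on `d`. [folklore] -/
theorem no_nullTop_eighteen_of_posRootLawOn {d : Fin 4 → ℕ} (hrow : PosRootLawOn 3 4 18 d) (h3 : ∀ l, l ≠ 3 → d l < d 3)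
    (S : Fin 4 → Matrix (Fin 3) (Fin 3) ℝ) (hS : ∀ l, (S l).IsSymm) (hdet : (S 3).det = 0)
    (k : Fin 3 → ℝ) (hk : k ⬝ᵥ ((S 3).adjugate *ᵥ k) ≠ 0) (s : ℝ) (a : Fin 19 → ℝ) :
    ¬ AltChain ((∑ l, (X : ℝ[X]) ^ d l • (S l).map C).det) 18 s a := by
  intro hchain
  obtain ⟨η, h19⟩ := nineteen_of_nullTop_eighteen d h3 S hdet k hk hchain
  have := hrow (fun l => S l + if l = 3 then η • Matrix.vecMulVec k k else 0) (perturb_rankOne_top_isSymm S hS k η)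
  omega

end Summit.ValiantsHypothesis.ValiantsHypothesis.Theorems.LacunarySymmetroidMatrixDescartes.Census
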